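import Summits.HodgeConjecture.HodgeConjecture.Theses.HeckeOrbitCompactness
import Literature.AlgebraicGeometry.HodgeTheory.AbelianVarietyEndomorphismsHOne
import Literature.AlgebraicGeometry.Motives.AbelianVarietyCohomologyExteriorH1
import HarnessLib

/-!
# Route `HeckeOrbitCompactness`, support item `WeilLinesRankOne` (stmt-HodgeConjecture-17829):
# THE WEIL EIGEN-LINES HAVE RANK `≤ 1`

The route's support item (child of the split of crux `OrbitDegreeBound`, stmt-HodgeConjecture-13689; also the
registered stub `stub_weilLinesRankOne` of line `k_saturation` on that crux): for a complex abelian `2n`-fold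
`(A, φ ≫ φ = -d·𝟙)`, `n, d ≥ 1`, each of the two Weil eigen-spaces `E₊ = weilClassesPlus A φ n d`,
`E₋ = weilClassesMinus A φ n d` of `H²ⁿ(A(ℂ); ℂ)` is spanned by any of its non-zero elements.

Proof: the tree's `weilClassesPlus_le_span_singleton` / `weilClassesMinus_le_span_singleton` (`E± = ⋀²ⁿ V±` are
LINES, `finrank_weilClassesPlus_eq_one` / `finrank_weilClassesMinus_eq_one`, van Geemen, proof of Thm. 6.12), fed
with `H•(A(ℂ); ℂ) = ⋀• H¹` and `b₁ = 2 dim A` (`hasExteriorCohomologyH1_complexPoints`, `finrank_complexBetti_one`).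

HONEST STATUS. A support item (linear algebra of the Weil plane); nothing here is a case of the Hodge conjecture.
No definition, no named fact, no sorry.
References: [vanGeemen1994HodgeAV] 4.9 and proof of Thm. 6.12; [Deligne1982HodgeCycles] (4.4).
-/

set_option linter.dupNamespace false

noncomputable section

open CategoryTheory
open Literature.AlgebraicGeometry Literature.AlgebraicGeometry.Motives Literature.AlgebraicGeometry.HodgeTheory
open Literature.AlgebraicTopology.SingularHomology

namespace Summit.HodgeConjecture.HodgeConjecture.Theorems

/-- **`WeilLinesRankOne`** (item stmt-HodgeConjecture-17829 of route `HeckeOrbitCompactness`): the Weil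
eigen-spaces `E₊`, `E₋` of a complex abelian `2n`-fold with `φ² = -d` (`n, d ≥ 1`) are spanned by any non-zero
element. [cite: vanGeemen1994HodgeAV, 4.9 and proof of Thm. 6.12] [cite: Deligne1982HodgeCycles, (4.4)] -/
theorem heckeOrbitCompactness_weilLinesRankOne_proof :
    Summit.HodgeConjecture.HodgeConjecture.Theses.HeckeOrbitCompactness.WeilLinesRankOne := by
  intro n d hn hd A φ hA _hX hφ
  have hΛ : HasExteriorCohomologyH1 ℂ (Motives.ComplexPoints A.X) :=
    Motives.AbelianVariety.hasExteriorCohomologyH1_complexPoints A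
  have hb₁ : Module.finrank ℂ (complexBetti A.X 1) = 2 * (2 * n) := by
    rw [Motives.AbelianVariety.finrank_complexBetti_one, hA]
  refine ⟨fun c hc hc0 c' hc' ↦ ?_, fun c hc hc0 c' hc' ↦ ?_⟩
  · obtain ⟨μ, hμ⟩ := Submodule.mem_span_singleton.mp
      (weilClassesPlus_le_span_singleton hΛ hb₁ hd hφ hc hc0 hc')
    exact ⟨μ, hμ.symm⟩
  · obtain ⟨μ, hμ⟩ := Submodule.mem_span_singleton.mp
      (weilClassesMinus_le_span_singleton hΛ hb₁ hd hφ hc hc0 hc')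
    exact ⟨μ, hμ.symm⟩

end Summit.HodgeConjecture.HodgeConjecture.Theorems

end
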